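import Mathlib

/-!
# CuspidalDescent — K1a arithmetic certificate (g36)

Companion to `CuspidalDescentK1a-g36.md` (crux `EllipticUnitValueSevenOfGZK`, idea
`cuspidal-descent-kolyvagin-nonvanishing`, item K1a).  Only finite arithmetic is certified here;
the cohomological statements (Prop. K) are on paper in the memo.

* `psi_square_candidates` : the isogeny character `ψ = ω^i` of `E[𝔭]` (`E = 49a1`) satisfies
  `ψ² = ω·χ_{-7} = ω⁴`, i.e. `2 i ≡ 4 (mod 6)`, whose solutions are exactly `i ∈ {2, 5}` (memo §1(b)).
* `label_power_five_bijective`, `label_square_not_injective` : the cusp labelling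
  `a ↦ T_{2a}` (`a ∈ (ℤ/7)^×`) intertwines `a ↦ t·a` with `T ↦ ψ(σ_t) T = t^i T`; six distinct points
  force `a ↦ a^i` to be a bijection of `(ℤ/7)^×`, true for `i = 5`, false for `i = 2` (memo §1(c)),
  so `ψ = ω⁵`.
* `eigen_separation` : `g⁵ - g` is a unit mod 7 for the generator `g = 3` of `(ℤ/7)^×`
  (the `ω⁵`- and `ω¹`-eigenspaces of an `𝔽₇[Δ]`-module meet in `0`; memo Lemma 4(b)).
* `quotient_character` : `1 - 5 ≡ 2 (mod 6)`: `E'[φ̂] ≅ μ₇ ⊗ ψ⁻¹ = 𝔽₇(ω²)` (memo §1(d)).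
* `kolyvagin_constant_dies` : for `ℓ ≡ -1 (mod 7)`, `D_ℓ` applied to a `G_ℓ`-fixed class multiplies it
  by `Σ_{i<ℓ+1} i = ℓ(ℓ+1)/2 ≡ 0 (mod 7)`; checked for the first inert Kolyvagin primes
  `ℓ ∈ {13, 41, 83, 97}` and in closed form (memo Lemma 3(c)).
-/

set_option linter.dupNamespace false

namespace Summit.BirchSwinnertonDyer.BirchSwinnertonDyer.Cruxes.EllipticUnitValueSevenOfGZK.CuspidalDescent.K1a

/-- `ψ² = ω⁴` in the character group `ℤ/6` of `Gal(ℚ(μ₇)/ℚ)`: the solutions of `2i = 4`. -/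
theorem psi_square_candidates : ∀ i : ZMod 6, 2 * i = 4 ↔ (i = 2 ∨ i = 5) := by decide

/-- `a ↦ a⁵` is a bijection of `(ℤ/7)^×` (so `ψ = ω⁵` is compatible with six distinct `T_{2a}`). -/
theorem label_power_five_bijective :
    Function.Bijective (fun a : (ZMod 7)ˣ => a ^ 5) := by decide

/-- `a ↦ a²` is not injective on `(ℤ/7)^×` (so `ψ = ω²` is incompatible with six distinct `T_{2a}`). -/
theorem label_square_not_injective :
    ¬ Function.Injective (fun a : (ZMod 7)ˣ => a ^ 2) := by decide

/-- `3` generates `(ℤ/7)^×`. -/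
theorem three_generates : orderOf (3 : ZMod 7) = 6 := by
  rw [orderOf_eq_iff (by norm_num)]
  refine ⟨by decide, ?_⟩
  intro m hm hpos
  interval_cases m <;> decide

/-- `ω⁵(σ) - ω(σ) = 3⁵ - 3` is a unit mod 7: the `ω⁵`- and `ω`-eigenspaces are disjoint. -/
theorem eigen_separation : IsUnit ((3 : ZMod 7) ^ 5 - 3) := by decide

/-- The quotient character: `E'[φ̂] ≅ Hom(E[φ], μ₇) = 𝔽₇(ω^{1-5}) = 𝔽₇(ω²)` (`1 - 5 = 2` in `ℤ/6`). -/
theorem quotient_character : (1 : ZMod 6) - 5 = 2 := by decide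

/-- Twisting by `χ_{-7} = ω³` swaps the two candidates: `5 + 3 = 2` and `2 + 3 = 5` in `ℤ/6`
(`49a3 = 49a1^{(-7)}` has `𝔭`-torsion character `ω²`). -/
theorem twist_swaps : (5 : ZMod 6) + 3 = 2 ∧ (2 : ZMod 6) + 3 = 5 := by decide

/-- `D_ℓ c = (Σ_{i=0}^{ℓ} i) c` for a `G_ℓ`-fixed class `c`; the scalar vanishes mod 7 when `7 ∣ ℓ + 1`.
Closed form. -/
theorem kolyvagin_constant_dies (ℓ : ℕ) (h : 7 ∣ ℓ + 1) : (7 : ℤ) ∣ (ℓ : ℤ) * (ℓ + 1) / 2 := by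
  obtain ⟨k, hk⟩ := h
  have hk' : (ℓ : ℤ) + 1 = 7 * k := by exact_mod_cast hk
  have : (ℓ : ℤ) * (ℓ + 1) / 2 = (ℓ : ℤ) * (ℓ + 1) / 2 := rfl
  have h2 : (2 : ℤ) ∣ (ℓ : ℤ) * (ℓ + 1) := by
    have := Int.even_mul_succ_self (ℓ : ℤ)
    exact even_iff_two_dvd.mp this
  obtain ⟨m, hm⟩ := h2
  rw [hm, Int.mul_ediv_cancel_left _ (by norm_num)]
  have : (7 : ℤ) ∣ 2 * m := by rw [← hm, hk']; exact ⟨ℓ * k, by ring⟩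
  exact (Int.Prime.dvd_mul' (by norm_num) this).resolve_left (by norm_num)

/-- Gauss: `(∑_{i<n} i) = n (n-1) / 2` over `ℕ` (from `Finset.sum_range_id_mul_two`). -/
theorem sum_range_eq (n : ℕ) : (∑ i ∈ Finset.range n, i) = n * (n - 1) / 2 := by
  have h := Finset.sum_range_id_mul_two n
  omega

/-- The same scalar for the first inert Kolyvagin primes `ℓ ≡ -1 (mod 7)`, `ℓ ∈ {13, 41, 83, 97}`:
`Σ_{i ≤ ℓ} i = ℓ(ℓ+1)/2 ∈ {91, 861, 3486, 4753}`, all divisible by 7. -/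
theorem kolyvagin_constant_dies_examples :
    (∑ i ∈ Finset.range (13 + 1), i) % 7 = 0 ∧ (∑ i ∈ Finset.range (41 + 1), i) % 7 = 0 ∧
    (∑ i ∈ Finset.range (83 + 1), i) % 7 = 0 ∧ (∑ i ∈ Finset.range (97 + 1), i) % 7 = 0 := by
  simp only [sum_range_eq]; decide

/-- `Tr_χ` kills constants: a nontrivial character of a finite cyclic group sums to zero — the
instance used (order-2 quotient `χ = χ_D ∘ N` on `Gal(K″[|D|]/K″) ↠ {±1}`): `1 + (-1) = 0`. -/
theorem trace_chi_kills_constants : (1 : ZMod 7) + (-1) = 0 := by decide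

end Summit.BirchSwinnertonDyer.BirchSwinnertonDyer.Cruxes.EllipticUnitValueSevenOfGZK.CuspidalDescent.K1a
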